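import Mathlib.Algebra.Algebra.RestrictScalars
import Mathlib.RingTheory.TensorProduct.Basic
import Mathlib.RingTheory.PowerSeries.Order
import Mathlib.RingTheory.PowerSeries.Inverse
import Literature.NumberTheory.EllipticCurves.IwasawaSelmer
import Literature.NumberTheory.EllipticCurves.Tamagawa
import Literature.NumberTheory.EllipticCurves.GlobalMinimalModel
import HarnessLib

/-!
# `ℤ_p`-rank of the `Γ`-coinvariants of `X(E/K_∞)` and the corank of `Sel_{p^∞}(E/K)`

Trunk T-ELLARITH-M (topic `NumberTheory/EllipticCurves`); named facts requested by the route
`BirchSwinnertonDyer/PAdicOrder` (item `stmt-BirchSwinnertonDyer-0490`, work item `wi-04036`).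

Let `K` be a number field, `E/K` an elliptic curve (`W`, `[W.IsElliptic]`), `p` a prime,
`K_∞/K` the cyclotomic `ℤ_p`-extension (`κ : Literature.ZpExtension K p`, `κ.IsCyclotomic`) with
topological generator `γ` (`κ.IsTopGenerator γ`), and `X = X(E/K_∞)` the Iwasawa module of a
Pontryagin-dual datum `D : W.SelmerDualData κ γ` (file `IwasawaSelmer`), a
`Λ = ℤ_p⟦T⟧`-module with `T = γ - 1`. The `Γ`-coinvariants of `X` are `X_Γ = X/TX`
(`Literature.NumberTheory.EllipticCurves.IwasawaAlgebra.coinvariants`), Pontryagin dual to `Sel_{p^∞}(E/K_∞)^Γ`.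

* `Literature.IwasawaAlgebra.coinvariants p M = M ⧸ T M` and its `ℤ_p`-rank
  `Literature.IwasawaAlgebra.coinvariantsRank p M = dim_{ℚ_p} (ℚ_p ⊗_{ℤ_p} M/TM)`;
* `Literature.IwasawaAlgebra.mulTRat p M`: multiplication by `T` on `ℚ_p ⊗_{ℤ_p} M`
  (the `ℚ_p`-linear endomorphism whose semisimplicity is Greenberg's Conjecture 1.12 at `T`);
* **`Greenberg1999_coinvariantsRank_eq_selmerCorank`** (named fact): if `E` has good ordinary
  reduction at every prime of `K` above `p`, then `X/TX` is a finitely generated `ℤ_p`-module and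
  `rank_{ℤ_p} X/TX = corank_{ℤ_p} Sel_{p^∞}(E/K)` — a consequence of Mazur's control theorem
  (Greenberg 1999, Thm. 1.2; in tree `WeierstrassCurve.selmer_control`) at the layer `n = 0`
  together with `(Sel_∞^Γ)^∨ = X/TX`; Greenberg (1999), §1, p. 5 (after Conj. 1.3) and p. 9
  (after Conj. 1.12);
* **`Greenberg1999_coinvariantsRank_eq_selmerCorank_rat`**: the same statement for `K = ℚ`
  with "good ordinary at `p`" spelled as in the rest of the BSD files
  (`W.HasGoodReductionAtPrime p ∧ p ∤ a_p(W)`, i.e. `Literature.IsOrdinaryAt W p` of file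
  `PAdicLFunction`, not imported here to keep the import closure small);
* **`Greenberg1999_order_charGenerator_eq_coinvariantsRank`** (named fact): for a finitely
  generated torsion `Λ`-module `X` with characteristic ideal `(f)`, if `T` acts semisimply on the
  `T`-primary part of `ℚ_p ⊗_{ℤ_p} X` (`ker T² = ker T`), then the power of `T` dividing `f`
  (`PowerSeries.order f`) equals `rank_{ℤ_p} X/TX`; Greenberg (1999), §1, p. 9, states this
  assuming his Conjecture 1.12 (complete reducibility of the `Γ`-action on `X ⊗_{ℤ_p} ℚ_p`,
  "`a_i = 1` for all `i` such that `f_i(T)` is not an associate of `p`" in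
  `X ∼ ⊕ Λ/(f_i^{a_i})`); by the structure theorem (Washington, Thm. 13.12) both sides only see
  the summands with `(f_i) = (T)`: `rank_{ℤ_p} X/TX = #{i : (f_i) = (T)}` and
  `ord_T f = ∑_{(f_i) = (T)} a_i`, so only `a_i = 1` for `(f_i) = (T)` is used, which is the
  hypothesis recorded here.

None of the three facts is discharged here: the first two need the control theorem and
Pontryagin duality for `Sel_∞` (tree facts `selmer_control`, `selmerGroupOver_top`), the third the
structure theorem for finitely generated torsion `Λ`-modules
(`Literature.NumberTheory.EllipticCurves.exists_isPseudoIsomorphism_elementary`, itself a named fact).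

## Mathlib reuse

`PowerSeries.X`, `PowerSeries.order` (`ℕ∞`-valued; `⊤` only for `f = 0`), `Ideal.span`,
`Submodule.smul` (`I • ⊤`), quotient modules, `RestrictScalars ℤ_[p] Λ M` (the `ℤ_p`-module
underlying a `Λ`-module, as in `Literature.NumberTheory.EllipticCurves.lambdaInvariant`), `RestrictScalars.lsmul` (the action of
`Λ` by `ℤ_p`-linear maps), `LinearMap.baseChange`, `TensorProduct`, `Module.finrank`,
`Module.Finite`, `Module.IsTorsion`. Mathlib has no Iwasawa modules / Selmer groups (see
`IwasawaSelmer`).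

## Design choices

* `coinvariantsRank p M` is *defined as* `Literature.lambdaInvariant p (coinvariants p M)`
  (`coinvariantsRank_eq_lambdaInvariant : … = … := rfl`, so `lambdaInvariant` lemmas rewrite
  after `unfold coinvariantsRank`); it is given its own name because "the `λ`-invariant of
  `X/TX`" is not how the literature refers to `rank_{ℤ_p} X_Γ`.
* The `ℤ_p`-rank is measured as `dim_{ℚ_p} ℚ_p ⊗_{ℤ_p} (·)` (junk value `0` in infinite
  dimension, `Module.finrank`); the first fact therefore also records that `X/TX` is finitely
  generated over `ℤ_p` (Greenberg 1999, p. 5: "by theorem 1.2, `X/TX` is finitely generated over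
  `ℤ_p`"), which makes the rank statement non-vacuous.
* Hypotheses of the number-field version are transcribed from `WeierstrassCurve.selmer_control`
  (Greenberg, Thm. 1.2): good reduction and the unit-root condition at every `v ∣ p`, `κ`
  cyclotomic; plus `κ.IsTopGenerator γ` so that `T = γ - 1` computes `Γ`-coinvariants.
* Everything lives in `namespace Literature` / `namespace Literature.IwasawaAlgebra`; nothing is added to
  Mathlib namespaces.

## References

* R. Greenberg, *Iwasawa theory for elliptic curves*, in: Arithmetic theory of elliptic curves
  (Cetraro 1997), LNM 1716, Springer (1999), 51–144 (arXiv:math/9809206): Thm. 1.2 (Mazur's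
  control theorem), §1 p. 5 (finite generation of `X/TX` and of `X`), Conj. 1.12 and the paragraph
  following it (p. 9).
* B. Mazur, *Rational points of abelian varieties with values in towers of number fields*,
  Invent. Math. 18 (1972), 183–266, §6.
* L. Washington, *Introduction to Cyclotomic Fields*, GTM 83, §13.2 (Thm. 13.12, Prop. 13.8).
* J. Neukirch, A. Schmidt, K. Wingberg, *Cohomology of Number Fields*, 2nd ed., Grundlehren 323,
  Springer (2008), Ch. V §3, structure theorem (5.3.8).
-/

noncomputable section

open scoped TensorProduct

universe u

namespace Literature.NumberTheory.EllipticCurves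

namespace IwasawaAlgebra

variable (p : ℕ) [Fact p.Prime] (M : Type*) [AddCommGroup M] [Module (IwasawaAlgebra p) M]

/-- The **`Γ`-coinvariants** `M_Γ = M/TM` of a `Λ = ℤ_p⟦T⟧`-module `M` (`T = γ - 1` for a
topological generator `γ` of `Γ ≅ ℤ_p`): the quotient of `M` by the submodule `(T) • M`. For
`M = X(E/K_∞)` this is the Pontryagin dual of `Sel_{p^∞}(E/K_∞)^Γ`.
Greenberg (1999), §1 (p. 5, p. 9); Washington, §13.2. [cite: Greenberg1999, §1 p. 5] -/
abbrev coinvariants : Type _ :=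
  M ⧸ (Ideal.span {(PowerSeries.X : IwasawaAlgebra p)} • (⊤ : Submodule (IwasawaAlgebra p) M))

/-- The image of `T • x` in `M/TM` vanishes. [folklore] -/
theorem coinvariants_mk_X_smul (x : M) :
    (Submodule.Quotient.mk ((PowerSeries.X : IwasawaAlgebra p) • x) : coinvariants p M) = 0 := by
  rw [Submodule.Quotient.mk_eq_zero]
  exact Submodule.smul_mem_smul (Ideal.subset_span rfl) Submodule.mem_top

/-- Non-vacuity: `Λ_Γ = Λ/TΛ ≅ ℤ_p` is nonzero — the class of `1` does not vanish, since `T` is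
not a unit of `Λ` (its constant coefficient is `0`). [folklore] -/
theorem coinvariants_mk_one_ne_zero :
    (Submodule.Quotient.mk (1 : IwasawaAlgebra p) : coinvariants p (IwasawaAlgebra p)) ≠ 0 := by
  intro h
  rw [Submodule.Quotient.mk_eq_zero, Ideal.smul_top_eq_map] at h
  simp only [Submodule.restrictScalars_mem, Algebra.algebraMap_self, Ideal.map_id,
    Ideal.mem_span_singleton] at h
  have hu : IsUnit (PowerSeries.X : IwasawaAlgebra p) := isUnit_of_dvd_one h
  rw [PowerSeries.isUnit_iff_constantCoeff] at hu
  simp at hu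

/-- The **`ℤ_p`-rank of the `Γ`-coinvariants** `rank_{ℤ_p} M/TM`, measured as
`dim_{ℚ_p} (ℚ_p ⊗_{ℤ_p} M/TM)` (`Module.finrank`, junk value `0` if this is
infinite-dimensional; meaningful when `M/TM` is a finitely generated `ℤ_p`-module, e.g. for
`M = X(E/K_∞)` under the control theorem). Greenberg (1999), §1 p. 9
("`rank_{ℤ_p}(X_E(F_∞)/T X_E(F_∞))`"). [cite: Greenberg1999, §1 p. 9] -/
def coinvariantsRank : ℕ :=
  lambdaInvariant p (coinvariants p M)

/-- `coinvariantsRank p M` is, by definition, the `λ`-invariant `dim_{ℚ_p} (· ⊗ ℚ_p)` of the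
`Λ`-module `M/TM` (`Literature.NumberTheory.EllipticCurves.lambdaInvariant`). [folklore] -/
theorem coinvariantsRank_eq_lambdaInvariant :
    coinvariantsRank p M = lambdaInvariant p (coinvariants p M) :=
  rfl

/-- Unfolding: `coinvariantsRank p M = dim_{ℚ_p} (ℚ_p ⊗_{ℤ_p} M/TM)`. [folklore] -/
theorem coinvariantsRank_eq_finrank :
    coinvariantsRank p M = Module.finrank ℚ_[p]
      (ℚ_[p] ⊗[ℤ_[p]] RestrictScalars ℤ_[p] (IwasawaAlgebra p) (coinvariants p M)) :=
  rfl

/-- **Multiplication by `T` on `V = ℚ_p ⊗_{ℤ_p} M`**, as a `ℚ_p`-linear endomorphism (base change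
of the `ℤ_p`-linear map `x ↦ T • x`, `RestrictScalars.lsmul`). For `M = X(E/K_∞)` finitely
generated and `Λ`-torsion, `V` is a `λ`-dimensional `ℚ_p`-vector space on which `Γ` acts through
`γ ↦ 1 + T`; Greenberg's Conjecture 1.12 is the semisimplicity of this endomorphism.
Greenberg (1999), Conj. 1.12. [cite: Greenberg1999, Conj. 1.12] -/
def mulTRat : (ℚ_[p] ⊗[ℤ_[p]] RestrictScalars ℤ_[p] (IwasawaAlgebra p) M) →ₗ[ℚ_[p]]
    (ℚ_[p] ⊗[ℤ_[p]] RestrictScalars ℤ_[p] (IwasawaAlgebra p) M) :=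
  LinearMap.baseChange ℚ_[p]
    (RestrictScalars.lsmul ℤ_[p] (IwasawaAlgebra p) M (PowerSeries.X : IwasawaAlgebra p))

/-- `mulTRat` on pure tensors: `a ⊗ x ↦ a ⊗ (T • x)`. [folklore] -/
@[simp] theorem mulTRat_tmul (a : ℚ_[p]) (x : M) :
    mulTRat p M (a ⊗ₜ[ℤ_[p]] (show RestrictScalars ℤ_[p] (IwasawaAlgebra p) M from x)) =
      a ⊗ₜ[ℤ_[p]] (show RestrictScalars ℤ_[p] (IwasawaAlgebra p) M from
        ((PowerSeries.X : IwasawaAlgebra p) • x)) := by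
  simp only [mulTRat, LinearMap.baseChange_tmul]
  rfl

end IwasawaAlgebra

/-! ## Named facts -/

section Facts

open NumberField IsDedekindDomain IwasawaAlgebra

/-- **`rank_{ℤ_p} X(E/K_∞)_Γ = corank_{ℤ_p} Sel_{p^∞}(E/K)`** (named fact; consequence of Mazur's
control theorem). Let `E/K` be an elliptic curve over a number field with good ordinary
reduction at every prime of `K` above `p` (`HasGoodReductionAt`, `HasUnitRootAt`, as in
`WeierstrassCurve.selmer_control`), `K_∞/K` the cyclotomic `ℤ_p`-extension (`hκ`) with
topological generator `γ` (`hγ`), and `X = X(E/K_∞)` the Iwasawa module of `D` (`T = γ - 1`).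
Then `X/TX` is a finitely generated `ℤ_p`-module and
`rank_{ℤ_p} (X/TX) = corank_{ℤ_p} Sel_{p^∞}(E/K)` (`W.selmerCorank p`).
Proof in print: `X/TX` is Pontryagin dual to `Sel_{p^∞}(E/K_∞)^Γ`, and by the control theorem
(Greenberg, Thm. 1.2, layer `n = 0`) the restriction `Sel_{p^∞}(E/K) → Sel_{p^∞}(E/K_∞)^Γ` has
finite kernel and cokernel, while `X_E(K) = Sel_{p^∞}(E/K)^∨` is finitely generated over `ℤ_p`.
Greenberg (1999), Thm. 1.2, §1 p. 5 ("by theorem 1.2, `X/TX` is finitely generated over `ℤ_p`")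
and §1 p. 9 ("`corank_{ℤ_p}(Sel_E(F)_p)`, which is equal to `rank_{ℤ_p}(X_E(F_∞)/TX_E(F_∞))`");
Mazur (1972), §6. [cite: Greenberg1999, Thm. 1.2 and §1 p. 9] -/
def Greenberg1999_coinvariantsRank_eq_selmerCorank : Prop :=
  ∀ {K : Type u} [Field K] [NumberField K] (W : WeierstrassCurve K) [W.IsElliptic]
    {p : ℕ} [Fact p.Prime] (κ : ZpExtension K p) (γ : Field.absoluteGaloisGroup K)
    (_hκ : κ.IsCyclotomic) (_hγ : κ.IsTopGenerator γ)
    (_hp : ∀ v : HeightOneSpectrum (𝓞 K), (p : 𝓞 K) ∈ v.asIdeal →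
      W.HasGoodReductionAt v ∧ W.HasUnitRootAt v)
    (D : W.SelmerDualData κ γ),
    Module.Finite ℤ_[p] (RestrictScalars ℤ_[p] (IwasawaAlgebra p) (coinvariants p D.X)) ∧
      coinvariantsRank p D.X = W.selmerCorank p

/-- **`rank_{ℤ_p} X(E/ℚ_∞)_Γ = corank_{ℤ_p} Sel_{p^∞}(E/ℚ)`** (named fact, the case `K = ℚ` of
`Greenberg1999_coinvariantsRank_eq_selmerCorank`, with "good ordinary reduction at `p`" spelled
prime-wise as in the BSD statement files: `W.HasGoodReductionAtPrime p` and `p ∤ a_p(W)` for the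
globally minimal model `W`, i.e. `Literature.IsOrdinaryAt W p`). Let `E/ℚ` be an elliptic curve with
globally minimal model `W`, `p` a prime of good ordinary reduction, `ℚ_∞/ℚ` the cyclotomic
`ℤ_p`-extension (`hκ`) with topological generator `γ` (`hγ`), `X = X(E/ℚ_∞)` the Iwasawa module
of `D` (`T = γ - 1`). Then `X/TX` is a finitely generated `ℤ_p`-module and
`rank_{ℤ_p} (X/TX) = corank_{ℤ_p} Sel_{p^∞}(E/ℚ)`. (To be discharged later from
`Greenberg1999_coinvariantsRank_eq_selmerCorank` once the bridges
`HasGoodReductionAtPrime p ↔ ∀ v ∣ p, HasGoodReductionAt v` and `p ∤ a_p ↔ HasUnitRootAt v` are in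
tree.)
Greenberg (1999), Thm. 1.2 and §1 p. 5, p. 9; Mazur (1972), §6. [cite: Greenberg1999, Thm. 1.2 and §1 p. 9] -/
def Greenberg1999_coinvariantsRank_eq_selmerCorank_rat : Prop :=
  ∀ (W : WeierstrassCurve ℚ) [W.IsElliptic] [W.IsGloballyMinimal] (p : ℕ) [Fact p.Prime]
    (_hgood : W.HasGoodReductionAtPrime p) (_hord : ¬ (p : ℤ) ∣ W.frobeniusTrace p)
    (κ : ZpExtension ℚ p) (γ : Field.absoluteGaloisGroup ℚ)
    (_hκ : κ.IsCyclotomic) (_hγ : κ.IsTopGenerator γ) (D : W.SelmerDualData κ γ),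
    Module.Finite ℤ_[p] (RestrictScalars ℤ_[p] (IwasawaAlgebra p) (coinvariants p D.X)) ∧
      coinvariantsRank p D.X = W.selmerCorank p

/-- **`ord_{T=0} f_X = rank_{ℤ_p} X/TX` under `T`-semisimplicity** (named fact; a consequence of
the structure theorem for finitely generated torsion `Λ`-modules). Let `X` be a
finitely generated torsion `Λ`-module whose characteristic ideal is generated by `f ∈ Λ`
(`Literature.Module.charIdeal Λ X = (f)`), and assume that `T` acts semisimply on the `T`-primary part
of `V = ℚ_p ⊗_{ℤ_p} X`, i.e. `ker (T² : V → V) = ker (T : V → V)` (`mulTRat`). Then the power of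
`T` dividing `f` (`PowerSeries.order f`, in `ℕ∞`; the statement forces `f ≠ 0`) equals
`rank_{ℤ_p} (X/TX)` (`coinvariantsRank`).
Greenberg (1999), §1 p. 9, states: assuming Conjecture 1.12 (the action of `Γ` on
`X ⊗_{ℤ_p} ℚ_p` is completely reducible, "that is, `a_i = 1` for all `i`'s such that `f_i(T)`
is not an associate of `p`" in `X ∼ ⊕ᵢ Λ/(f_i(T)^{a_i})`), `rank_{ℤ_p}(X/TX)` "would equal the
power of `T` dividing `f_E(T)`". By the structure theorem (Washington, Thm. 13.12, Prop. 13.8;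
tree fact `Literature.NumberTheory.EllipticCurves.exists_isPseudoIsomorphism_elementary`) `rank_{ℤ_p} X/TX = #{i : (f_i) = (T)}`
and `ord_T f = ∑_{(f_i) = (T)} a_i`, so of Conjecture 1.12 only "`a_i = 1` whenever
`(f_i) = (T)`" enters, which is the hypothesis `ker T² = ker T` on `V` recorded here. The
statement in this generality is the structure-theorem computation (Washington, §13.2:
Thm. 13.12 with Prop. 13.8, `Λ/(f) ≅ ℤ_p^{deg f}` for distinguished `f`; Neukirch–Schmidt–Wingberg
(5.3.8)); Greenberg's p. 9 remark is the motivating special case.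
[cite: Washington1997, §13.2 (Thm. 13.12, Prop. 13.8)]
[cite: NeukirchSchmidtWingberg2008, (5.3.8)]
[cite: Greenberg1999, §1 p. 9 (after Conj. 1.12)] -/
def Greenberg1999_order_charGenerator_eq_coinvariantsRank : Prop :=
  ∀ (p : ℕ) [Fact p.Prime] (X : Type u) [AddCommGroup X] [Module (IwasawaAlgebra p) X]
    [Module.Finite (IwasawaAlgebra p) X] (_hX : Module.IsTorsion (IwasawaAlgebra p) X)
    (f : IwasawaAlgebra p) (_hf : Module.charIdeal (IwasawaAlgebra p) X = Ideal.span {f})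
    (_hss : LinearMap.ker (mulTRat p X ∘ₗ mulTRat p X) = LinearMap.ker (mulTRat p X)),
    f.order = (coinvariantsRank p X : ℕ∞)

end Facts

end Literature.NumberTheory.EllipticCurves
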